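import Summits.KontsevichZagierPeriods.KontsevichZagierPeriods.Theorems.RootDecompWalshStrataHtypeLineDegenerate

/-!
# Root decomposition (Walsh strata), part 56 — H-type XI: line-edge family, perfect-square radicand

The last degenerate sub-family of the line-edge residual: `e′ = e − mκ₁² ≠ 0` and `4e′g′ = f′²`, so the
radicand is the PERFECT SQUARE `P = e′(x − ρ)²`, `ρ = mκ₀κ₁/e′ ∈ ℚ`.  If `e′ < 0` the domain is empty; if
`κ₀ = 0` then `g = 0` and the integrand vanishes; otherwise `g > 0` and on each side of `x = ρ`
(sign `s = ±1`) `√P = s√e′·(x − ρ)`, so the integrand is `√e′ · M(x)/H(x)²` with the quintic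
`M = sγ(x − ρ)·Hi·(κ₁g − eκ₀x)`.  Its EVEN part `(sγA/3)·x²(ex² + 3g)/H²·√e′` (`A = κ₁g + eκ₀ρ`) is the
LANDED `InBaker.sqrt_const_even`; its ODD part is, in the chart `t = H` of part 55
(`InBaker.of_Hsq_chart`), `(C₀ + C₁/t + C₂/t²)·√e′` on a subset of `(g, e + g]` — the LANDED
`sqrt_const`, `sqrt_const_pole`, `sqrt_const_dpole`, glued by `of_sub'` with bounded representations.
With this the line-edge residual is DISCHARGED:
`quadricBakerDescent_of_residuals₉ : R-HCx° → R-Eθ → …Theses.RootDecompWalshStrata.QuadricBakerDescent`.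

References: [KontsevichZagier2001 §1.2 rules (1)–(3)], [BCR1998 §2.2].
-/

noncomputable section

open Set MeasureTheory MvPolynomial Literature.NumberTheory.Transcendental
open Literature.ModelTheory.ExponentialFields (IsSemialgebraic isSemialgebraic_univ isSemialgebraic_empty)
open Summit.KontsevichZagierPeriods.RootDecompWalshStrata.ConicDescent.VertexChart

namespace Summit.KontsevichZagierPeriods.RootDecompWalshStrata.ConicDescent.BallCube

/-- The open half-line `{t > g}` of `ℝ¹` is `ℚ`-semialgebraic. [BCR1998 §2.2] -/
private theorem isSemialgebraic_gt_const (g : ℚ) : IsSemialgebraic ℚ {t : Fin 1 → ℝ | (g : ℝ) < t 0} := by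
  convert Literature.ModelTheory.ExponentialFields.isSemialgebraic_setOf_eval_pos (k := ℚ) (R := ℝ)
    (MvPolynomial.X (0 : Fin 1) - MvPolynomial.C g : MvPolynomial (Fin 1) ℚ) using 1
  ext v
  simp only [mem_setOf_eq, map_sub, MvPolynomial.aeval_X, MvPolynomial.aeval_C, eq_ratCast, sub_pos]

/-! #### 56.1 Polynomial data of the even part -/

/-- `c·U·(eU + 3g)`, the even numerator in `U = x²`. [this node] -/
def hSqE (c e g : ℚ) : Polynomial ℚ :=
  Polynomial.C c * Polynomial.X * (Polynomial.C e * Polynomial.X + Polynomial.C (3 * g))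

/-- `eU + g` (`H` in `U = x²`). [this node] -/
def hHu (e g : ℚ) : Polynomial ℚ := Polynomial.C e * Polynomial.X + Polynomial.C g

/-- [bookkeeping] -/
theorem aeval_hSqE (c e g : ℚ) (u : ℝ) :
    Polynomial.aeval u (hSqE c e g) = (c : ℝ) * u * ((e : ℝ) * u + 3 * g) := by
  simp [hSqE]

/-- [bookkeeping] -/
theorem aeval_hHu (e g : ℚ) (u : ℝ) : Polynomial.aeval u (hHu e g) = (e : ℝ) * u + g := by
  simp [hHu]

/-! #### 56.2 One sign piece: even part + odd part in the chart `t = H` -/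

/-- **Perfect-square radicand, one sign piece.**  On a domain inside `[0,1] ∩ {s(x − ρ) > 0}` (`s = ±1`),
`γ·Hi·√(e′(x−ρ)²)·(κ₁g − eκ₀x)/H²` (`e, g, e′ > 0`) lies in the Baker sector: `√(e′(x−ρ)²) = s√e′(x−ρ)`,
even part by `sqrt_const_even`, odd part by the chart `t = H` and three scaled poles.
[KontsevichZagier2001 §1.2 rules (1)–(3); this node] -/
theorem InBaker.of_HLx_square_piece (e g γ k0 k1 e1 ρ s : ℚ) (he : 0 < e) (hg : 0 < g)
    (he1 : 0 < e1) (hs : s = 1 ∨ s = -1) (r : KZ.IntegralRep 1)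
    (hdom : ∀ v ∈ r.domain, (0 ≤ v 0 ∧ v 0 ≤ 1) ∧ 0 < (s : ℝ) * (v 0 - ρ))
    (hri : EqOn r.integrand (fun t => (γ : ℝ) * ((e : ℝ) / 3 * t 0 ^ 3 + g * t 0) *
      √((e1 : ℝ) * (t 0 - ρ) ^ 2) * (((k1 : ℝ) * g - e * k0 * t 0) / ((e : ℝ) * t 0 ^ 2 + g) ^ 2))
      r.domain) :
    InBaker (KZ.of r) := by
  have he0 : (0 : ℝ) < e := by exact_mod_cast he
  have hg0 : (0 : ℝ) < g := by exact_mod_cast hg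
  have he10 : (0 : ℝ) < e1 := by exact_mod_cast he1
  have hH : ∀ x : ℝ, 0 < (e : ℝ) * x ^ 2 + g := fun x => by positivity
  have hqD : ∀ y : ℝ, qD 0 0 e1 y = e1 := fun y => by simp [qD]
  have hsabs : ∀ y : ℝ, 0 < (s : ℝ) * y → |y| = (s : ℝ) * y := by
    intro y hy
    rcases hs with rfl | rfl
    · push_cast at hy ⊢
      rw [one_mul] at hy ⊢
      exact abs_of_pos hy
    · push_cast at hy ⊢
      have hy' : y < 0 := by linarith
      rw [abs_of_neg hy']
      ring
  obtain ⟨cE, hcE⟩ : ∃ c : ℚ, c = s * γ * (k1 * g + e * k0 * ρ) / 3 := ⟨_, rfl⟩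
  obtain ⟨C0, hC0⟩ : ∃ c : ℚ, c = -(s * γ * k0) / (6 * e) := ⟨_, rfl⟩
  obtain ⟨C1, hC1⟩ : ∃ c : ℚ, c = -(s * γ * g * (k0 + ρ * k1)) / (6 * e) := ⟨_, rfl⟩
  obtain ⟨C2, hC2⟩ : ∃ c : ℚ, c = s * γ * g ^ 2 * (k0 - ρ * k1) / (3 * e) := ⟨_, rfl⟩
  refine InBaker.of_split_at 0 r (fun r₂ hd₂ hi₂ => ?_) fun r₂ hd₂ hi₂ => ?_
  swap
  · -- `x < 0`: empty
    refine InBaker.of_domain_eq_empty r₂ ?_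
    rw [hd₂]
    refine Set.eq_empty_of_subset_empty fun v hv => ?_
    exfalso
    obtain ⟨⟨h00, -⟩, -⟩ := hdom v hv.1
    have h2 : v 0 < ((0 : ℚ) : ℝ) := hv.2
    rw [Rat.cast_zero] at h2
    linarith
  -- `x > 0`
  have hdom₂ : ∀ v ∈ r₂.domain, (0 < v 0 ∧ v 0 ≤ 1) ∧ 0 < (s : ℝ) * (v 0 - ρ) := fun v hv => by
    rw [hd₂] at hv
    obtain ⟨hv1, hv0⟩ := hv
    have hv0' : ((0 : ℚ) : ℝ) < v 0 := hv0
    rw [Rat.cast_zero] at hv0'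
    obtain ⟨⟨-, h1⟩, h2⟩ := hdom v hv1
    exact ⟨⟨hv0', h1⟩, h2⟩
  have hsq : ∀ v ∈ r₂.domain, √((e1 : ℝ) * (v 0 - ρ) ^ 2) = √(e1 : ℝ) * ((s : ℝ) * (v 0 - ρ)) :=
    fun v hv => by
      rw [Real.sqrt_mul' _ (sq_nonneg _), Real.sqrt_sq_eq_abs, hsabs _ (hdom₂ v hv).2]
  have hb₂ : Bornology.IsBounded r₂.domain := by
    refine isBounded_iff_forall_norm_le.2 ⟨1, fun t ht => ?_⟩
    refine (pi_norm_le_iff_of_nonneg zero_le_one).2 fun i => ?_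
    rw [Fin.eq_zero i, Real.norm_eq_abs, abs_le]
    exact ⟨by linarith [(hdom₂ t ht).1.1], (hdom₂ t ht).1.2⟩
  -- the even part, as a bounded representation on `r₂.domain`
  have hQne : ∀ v ∈ r₂.domain, Polynomial.aeval (v 0 ^ 2) (hHu e g ^ 2) ≠ 0 := fun v _ => by
    rw [map_pow, aeval_hHu]
    exact pow_ne_zero 2 (hH (v 0)).ne'
  have hfE : IsSemialgebraicFunOn ℚ r₂.domain fun v =>
      Polynomial.aeval (v 0 ^ 2) (hSqE cE e g) / Polynomial.aeval (v 0 ^ 2) (hHu e g ^ 2) *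
        √(qD 0 0 e1 (v 0)) :=
    (((((IsRatOn.coord.pow 2).polyAeval (hSqE cE e g)).div
      ((IsRatOn.coord.pow 2).polyAeval (hHu e g ^ 2)) hQne).isSemialgebraicFunOn
        r₂.isSemialgebraic_domain).mul_holds (IsSemialgebraicFunOn.sqrt_holds
          (isSemialgebraicFunOn_qD 0 0 e1 r₂.isSemialgebraic_domain))).congr fun t _ => by
      simp only [Pi.mul_apply]
  have hME : ∀ v ∈ r₂.domain,
      |Polynomial.aeval (v 0 ^ 2) (hSqE cE e g) / Polynomial.aeval (v 0 ^ 2) (hHu e g ^ 2) *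
        √(qD 0 0 e1 (v 0))| ≤ |(cE : ℝ)| * (((e : ℝ) + 3 * g) / (g : ℝ) ^ 2) * √(e1 : ℝ) := by
    intro v hv
    obtain ⟨⟨hx0, hx1⟩, -⟩ := hdom₂ v hv
    have hHv := hH (v 0)
    have hx2 : v 0 ^ 2 ≤ 1 := by nlinarith
    have hnn : 0 ≤ v 0 ^ 2 * ((e : ℝ) * v 0 ^ 2 + 3 * g) := by positivity
    have hnum : v 0 ^ 2 * ((e : ℝ) * v 0 ^ 2 + 3 * g) ≤ (e : ℝ) + 3 * g := by
      nlinarith [sq_nonneg (v 0), mul_nonneg he0.le (sq_nonneg (v 0))]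
    have hden : (g : ℝ) ^ 2 ≤ ((e : ℝ) * v 0 ^ 2 + g) ^ 2 := by
      nlinarith [mul_nonneg he0.le (sq_nonneg (v 0))]
    have hexpr : Polynomial.aeval (v 0 ^ 2) (hSqE cE e g) / Polynomial.aeval (v 0 ^ 2) (hHu e g ^ 2) *
        √(qD 0 0 e1 (v 0)) = (cE : ℝ) * (v 0 ^ 2 * ((e : ℝ) * v 0 ^ 2 + 3 * g) /
          ((e : ℝ) * v 0 ^ 2 + g) ^ 2) * √(e1 : ℝ) := by
      rw [aeval_hSqE, map_pow, aeval_hHu, hqD]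
      ring
    have hq : v 0 ^ 2 * ((e : ℝ) * v 0 ^ 2 + 3 * g) / ((e : ℝ) * v 0 ^ 2 + g) ^ 2 ≤
        ((e : ℝ) + 3 * g) / (g : ℝ) ^ 2 :=
      (div_le_div_of_nonneg_right hnum (pow_pos hHv 2).le).trans
        (div_le_div_of_nonneg_left (by positivity) (pow_pos hg0 2) hden)
    rw [hexpr, abs_mul, abs_mul, abs_of_nonneg (Real.sqrt_nonneg _),
      abs_of_nonneg (by positivity : (0 : ℝ) ≤ v 0 ^ 2 * ((e : ℝ) * v 0 ^ 2 + 3 * g) /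
        ((e : ℝ) * v 0 ^ 2 + g) ^ 2)]
    exact mul_le_mul_of_nonneg_right (mul_le_mul_of_nonneg_left hq (abs_nonneg _))
      (Real.sqrt_nonneg _)
  refine InBaker.of_sub' r₂ (bddRep r₂.domain r₂.isSemialgebraic_domain hb₂ _ hfE _ hME) rfl
    (InBaker.sqrt_const_even e1 he1 (hSqE cE e g) (hHu e g ^ 2) _ hQne fun v _ => rfl) ?_
  -- the odd part: chart `t = H`
  have hT := isSemialgebraic_gt_const g
  have hne : ∀ t ∈ {t : Fin 1 → ℝ | (g : ℝ) < t 0}, t 0 - ((0 : ℚ) : ℝ) ≠ 0 := fun t ht => by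
    have h2 : (g : ℝ) < t 0 := ht
    rw [Rat.cast_zero, sub_zero]
    exact (hg0.trans h2).ne'
  refine InBaker.of_Hsq_chart e g he _ (fun v hv => (hdom₂ v hv).1.1)
    (fun t => (C0 : ℝ) * √(qD 0 0 e1 (t 0)) + (C1 : ℝ) / (t 0 - ((0 : ℚ) : ℝ)) * √(qD 0 0 e1 (t 0)) +
      (C2 : ℝ) / (t 0 - ((0 : ℚ) : ℝ)) ^ 2 * √(qD 0 0 e1 (t 0))) ?_ (fun v hv => ?_)
    fun r₃ hd₃ hi₃ => ?_
  · -- semialgebraic on `{t > g}`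
    have hK := isSemialgebraicFunOn_ratCast hT C0
    have hA : IsRatOn {t : Fin 1 → ℝ | (g : ℝ) < t 0} fun t => (C1 : ℝ) / (t 0 - ((0 : ℚ) : ℝ)) :=
      (IsRatOn.const C1).div (IsRatOn.coord.sub (IsRatOn.const 0)) hne
    have hB : IsRatOn {t : Fin 1 → ℝ | (g : ℝ) < t 0} fun t => (C2 : ℝ) / (t 0 - ((0 : ℚ) : ℝ)) ^ 2 :=
      (IsRatOn.const C2).div ((IsRatOn.coord.sub (IsRatOn.const 0)).pow 2) fun t ht =>
        pow_ne_zero 2 (hne t ht)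
    have hsqr := IsSemialgebraicFunOn.sqrt_holds (isSemialgebraicFunOn_qD 0 0 e1 hT)
    exact (((hK.mul_holds hsqr).add_holds ((hA.isSemialgebraicFunOn hT).mul_holds hsqr)).add_holds
      ((hB.isSemialgebraicFunOn hT).mul_holds hsqr)).congr fun t _ => by
        simp only [Pi.add_apply, Pi.mul_apply]
  · -- the odd part of the integrand in the chart
    have hv' : v ∈ r₂.domain := hv
    have hv1 : v ∈ r.domain := by rw [hd₂] at hv'; exact hv'.1
    have hHne := (hH (v 0)).ne'
    have hene : (e : ℝ) ≠ 0 := he0.ne'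
    show r₂.integrand v - Polynomial.aeval (v 0 ^ 2) (hSqE cE e g) /
      Polynomial.aeval (v 0 ^ 2) (hHu e g ^ 2) * √(qD 0 0 e1 (v 0)) = _
    rw [hi₂, hri hv1]
    dsimp only
    rw [hsq v hv', aeval_hSqE, map_pow, aeval_hHu, hqD, hqD, Rat.cast_zero, sub_zero, hcE, hC0, hC1, hC2]
    push_cast
    field_simp
    ring
  · -- the pulled-back odd part: `C₀√e′ + C₁/t·√e′ + C₂/t²·√e′` on a subset of `(g, e + g]`
    have hdg : ∀ t ∈ r₃.domain, (g : ℝ) < t 0 := fun t ht => by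
      rw [hd₃] at ht; exact ht.1
    have hdle : ∀ t ∈ r₃.domain, t 0 ≤ (e : ℝ) + g := fun t ht => by
      rw [hd₃] at ht
      obtain ⟨ht1, ht2⟩ := ht
      have ht1' : (g : ℝ) < t 0 := ht1
      have ht2' : lift₁ (fun s => √((s - g) / e)) t ∈ r₂.domain := ht2
      obtain ⟨⟨-, h1⟩, -⟩ := hdom₂ _ ht2'
      simp only [lift₁_apply] at h1
      have hp : 0 ≤ (t 0 - g) / e := (div_pos (sub_pos.2 ht1') he0).le
      have h2 : (t 0 - g) / e ≤ 1 := by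
        nlinarith [Real.sqrt_nonneg ((t 0 - g) / e), Real.sq_sqrt hp]
      have h3 := (div_le_one he0).1 h2
      linarith
    have hb : Bornology.IsBounded r₃.domain := by
      refine isBounded_iff_forall_norm_le.2 ⟨(e : ℝ) + g, fun t ht => ?_⟩
      refine (pi_norm_le_iff_of_nonneg (by positivity)).2 fun i => ?_
      rw [Fin.eq_zero i, Real.norm_eq_abs, abs_le]
      exact ⟨by linarith [hdg t ht], hdle t ht⟩
    have hne₃ : ∀ t ∈ r₃.domain, t 0 - ((0 : ℚ) : ℝ) ≠ 0 := fun t ht => hne t (hdg t ht)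
    -- peel the constant summand
    have hfK : IsSemialgebraicFunOn ℚ r₃.domain fun t => (C0 : ℝ) * √(qD 0 0 e1 (t 0)) :=
      ((isSemialgebraicFunOn_ratCast r₃.isSemialgebraic_domain C0).mul_holds
        (IsSemialgebraicFunOn.sqrt_holds (isSemialgebraicFunOn_qD 0 0 e1 r₃.isSemialgebraic_domain))).congr
        fun t _ => by simp only [Pi.mul_apply]
    have hMK : ∀ t ∈ r₃.domain, |(C0 : ℝ) * √(qD 0 0 e1 (t 0))| ≤ |(C0 : ℝ)| * √(e1 : ℝ) := by
      intro t _
      rw [hqD, abs_mul, abs_of_nonneg (Real.sqrt_nonneg _)]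
    refine InBaker.of_sub' r₃ (bddRep r₃.domain r₃.isSemialgebraic_domain hb _ hfK _ hMK) rfl
      (InBaker.sqrt_const e1 C0 he1 _ fun t _ => rfl) ?_
    -- peel the simple pole
    have hfA : IsSemialgebraicFunOn ℚ r₃.domain
        fun t => (C1 : ℝ) / (t 0 - ((0 : ℚ) : ℝ)) * √(qD 0 0 e1 (t 0)) :=
      ((((IsRatOn.const C1).div (IsRatOn.coord.sub (IsRatOn.const 0)) hne₃).isSemialgebraicFunOn
        r₃.isSemialgebraic_domain).mul_holds (IsSemialgebraicFunOn.sqrt_holds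
          (isSemialgebraicFunOn_qD 0 0 e1 r₃.isSemialgebraic_domain))).congr fun t _ => by
        simp only [Pi.mul_apply]
    have hMA : ∀ t ∈ r₃.domain,
        |(C1 : ℝ) / (t 0 - ((0 : ℚ) : ℝ)) * √(qD 0 0 e1 (t 0))| ≤ |(C1 : ℝ)| / g * √(e1 : ℝ) := by
      intro t ht
      have htg := hdg t ht
      have ht0 : 0 < t 0 := hg0.trans htg
      rw [hqD, Rat.cast_zero, sub_zero, abs_mul, abs_div, abs_of_pos ht0,
        abs_of_nonneg (Real.sqrt_nonneg _)]
      exact mul_le_mul_of_nonneg_right (div_le_div_of_nonneg_left (abs_nonneg _) hg0 htg.le)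
        (Real.sqrt_nonneg _)
    refine InBaker.of_sub' _ (bddRep r₃.domain r₃.isSemialgebraic_domain hb _ hfA _ hMA) rfl
      (InBaker.sqrt_const_pole e1 0 C1 he1 _ fun t _ => rfl) ?_
    -- what is left is the double pole
    refine InBaker.sqrt_const_dpole e1 0 C2 he1 _ fun t _ => ?_
    show (r₃.integrand t - (C0 : ℝ) * √(qD 0 0 e1 (t 0))) -
      (C1 : ℝ) / (t 0 - ((0 : ℚ) : ℝ)) * √(qD 0 0 e1 (t 0)) = _
    rw [hi₃]
    ring

/-! #### 56.3 The perfect-square sub-family -/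

/-- **Line-edge family, PERFECT-SQUARE radicand** (`e′ = e − mκ₁² ≠ 0`, `4e′g′ = f′²`): empty domain if
`e′ < 0`, vanishing integrand if `κ₀ = 0` (then `g = 0`), otherwise `g > 0` and the two sign pieces
`x ≷ ρ` are `InBaker.of_HLx_square_piece`. [KontsevichZagier2001 §1.2 rules (1)–(3); this node] -/
theorem InBaker.of_HLx_square (e g m γ k0 k1 : ℚ) (he : 0 < e) (hm : 1 ≤ m)
    (h0 : e - m * k1 ^ 2 ≠ 0)
    (hdisc : (e - m * k1 ^ 2) * (4 * (e - m * k1 ^ 2) * (g - m * k0 ^ 2) - (2 * m * k0 * k1) ^ 2) = 0)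
    (S : Set (Fin 1 → ℝ)) (hS : IsSemialgebraic ℚ S)
    (hdom : ∀ t ∈ S, (0 ≤ t 0 ∧ t 0 ≤ 1) ∧ 0 < (e : ℝ) * t 0 ^ 2 + g ∧
      (m : ℝ) * ((k0 : ℝ) + k1 * t 0) ^ 2 < (e : ℝ) * t 0 ^ 2 + g)
    (r : KZ.IntegralRep 1) (hrd : r.domain = S)
    (hri : EqOn r.integrand (fun t => (γ : ℝ) * ((e : ℝ) / 3 * t 0 ^ 3 + g * t 0) *
      √((e : ℝ) * t 0 ^ 2 + g - m * ((k0 : ℝ) + k1 * t 0) ^ 2) *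
      (((k1 : ℝ) * g - e * k0 * t 0) / ((e : ℝ) * t 0 ^ 2 + g) ^ 2)) S) :
    InBaker (KZ.of r) := by
  have _hS := hS
  subst hrd
  have hm0 : 0 < m := zero_lt_one.trans_le hm
  obtain ⟨e1, he1⟩ : ∃ e1 : ℚ, e1 = e - m * k1 ^ 2 := ⟨_, rfl⟩
  rw [← he1] at h0 hdisc
  have hdisc' : 4 * e1 * (g - m * k0 ^ 2) = (2 * m * k0 * k1) ^ 2 := by
    have h := (mul_eq_zero.1 hdisc).resolve_left h0
    linarith
  obtain ⟨ρ, hρ⟩ : ∃ ρ : ℚ, ρ = m * k0 * k1 / e1 := ⟨_, rfl⟩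
  have hρ1 : e1 * ρ = m * k0 * k1 := by rw [hρ]; exact mul_div_cancel₀ _ h0
  have hρ2 : e1 * ρ ^ 2 = g - m * k0 ^ 2 := by
    have h3 : e1 * (e1 * ρ ^ 2) = e1 * (g - m * k0 ^ 2) := by
      rw [show e1 * (e1 * ρ ^ 2) = (e1 * ρ) ^ 2 by ring, hρ1]
      linear_combination (-1 / 4 : ℚ) * hdisc'
    exact mul_left_cancel₀ h0 h3
  have hradR : ∀ x : ℝ, (e : ℝ) * x ^ 2 + g - m * ((k0 : ℝ) + k1 * x) ^ 2 = (e1 : ℝ) * (x - ρ) ^ 2 := by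
    intro x
    have h1 : (e1 : ℝ) = e - m * k1 ^ 2 := by rw [he1]; push_cast; ring
    have h2 : (e1 : ℝ) * ρ = m * k0 * k1 := by exact_mod_cast hρ1
    have h3 : (e1 : ℝ) * ρ ^ 2 = g - m * k0 ^ 2 := by exact_mod_cast hρ2
    linear_combination (-(x ^ 2)) * h1 + (2 * x) * h2 - h3
  rcases lt_or_gt_of_ne h0 with hneg | hpos
  · -- `e′ < 0`: the domain is empty
    refine InBaker.of_domain_eq_empty r (Set.eq_empty_of_subset_empty fun v hv => ?_)
    exfalso
    obtain ⟨-, -, h3⟩ := hdom v hv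
    have hneg' : (e1 : ℝ) ≤ 0 := by exact_mod_cast hneg.le
    have h4 : (e1 : ℝ) * (v 0 - ρ) ^ 2 ≤ 0 := mul_nonpos_iff.2 (Or.inr ⟨hneg', sq_nonneg _⟩)
    linarith [hradR (v 0)]
  by_cases hk0 : k0 = 0
  · -- `κ₀ = 0`: then `ρ = 0`, `g = 0` and the integrand vanishes
    have hρ0 : ρ = 0 := by rw [hρ, hk0]; simp
    have hg0 : g = 0 := by
      have h := hρ2
      rw [hρ0, hk0] at h
      linarith
    exact InBaker.of_eqOn_ratCast r 0 fun v hv => by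
      rw [hri hv, hk0, hg0]
      simp
  -- `κ₀ ≠ 0`: `g > 0`; split at `ρ`
  have hk0sq : 0 < k0 ^ 2 := lt_of_le_of_ne (sq_nonneg k0) (Ne.symm (pow_ne_zero 2 hk0))
  have hg : 0 < g := by nlinarith [mul_nonneg hpos.le (sq_nonneg ρ), mul_pos hm0 hk0sq, hρ2]
  refine InBaker.of_split_at ρ r (fun r₁ hd₁ hi₁ => ?_) fun r₁ hd₁ hi₁ => ?_
  · -- `x > ρ`
    refine InBaker.of_HLx_square_piece e g γ k0 k1 e1 ρ 1 he hg hpos (Or.inl rfl) r₁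
      (fun v hv => ?_) fun v hv => ?_
    · rw [hd₁] at hv
      obtain ⟨hvS, hvρ⟩ := hv
      have hvρ' : (ρ : ℝ) < v 0 := hvρ
      refine ⟨(hdom v hvS).1, ?_⟩
      push_cast
      linarith
    · have hvS : v ∈ r.domain := by rw [hd₁] at hv; exact hv.1
      rw [hi₁, hri hvS]
      dsimp only
      rw [hradR]
  · -- `x < ρ`
    refine InBaker.of_HLx_square_piece e g γ k0 k1 e1 ρ (-1) he hg hpos (Or.inr rfl) r₁
      (fun v hv => ?_) fun v hv => ?_
    · rw [hd₁] at hv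
      obtain ⟨hvS, hvρ⟩ := hv
      have hvρ' : v 0 < (ρ : ℝ) := hvρ
      refine ⟨(hdom v hvS).1, ?_⟩
      push_cast
      linarith
    · have hvS : v ∈ r.domain := by rw [hd₁] at hv; exact hv.1
      rw [hi₁, hri hvS]
      dsimp only
      rw [hradR]

/-! #### 56.4 The line-edge residual discharged; head -/

/-- **`R-HLx°°` holds**: the perfect-square sub-family is `InBaker.of_HLx_square`. [this node] -/
theorem InBaker.of_Hlines_xdd :
    (∀ (e g m γ k0 k1 : ℚ), 0 < e → 1 ≤ m → e - m * k1 ^ 2 ≠ 0 →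
      (e - m * k1 ^ 2) * (4 * (e - m * k1 ^ 2) * (g - m * k0 ^ 2) - (2 * m * k0 * k1) ^ 2) = 0 →
      ∀ (S : Set (Fin 1 → ℝ)), IsSemialgebraic ℚ S →
        (∀ t ∈ S, (0 ≤ t 0 ∧ t 0 ≤ 1) ∧ 0 < (e : ℝ) * t 0 ^ 2 + g ∧
          (m : ℝ) * ((k0 : ℝ) + k1 * t 0) ^ 2 < (e : ℝ) * t 0 ^ 2 + g) →
        ∀ r : KZ.IntegralRep 1, r.domain = S →
          EqOn r.integrand (fun t => (γ : ℝ) * ((e : ℝ) / 3 * t 0 ^ 3 + g * t 0) *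
            √((e : ℝ) * t 0 ^ 2 + g - m * ((k0 : ℝ) + k1 * t 0) ^ 2) *
            (((k1 : ℝ) * g - e * k0 * t 0) / ((e : ℝ) * t 0 ^ 2 + g) ^ 2)) S →
          InBaker (KZ.of r)) := by
  intro e g m γ k0 k1 he hm h0 hdisc S hS hdom r hrd hri
  exact InBaker.of_HLx_square e g m γ k0 k1 he hm h0 hdisc S hS hdom r hrd hri

/-! #### 56.5 Head -/

/-- **`QuadricBakerDescent` from TWO typed residuals, v9.**  The line-edge family of the H-type stratum is
DISCHARGED (parts 53, 55, 56); what remains of the `d = 3` slice `QuadricBakerDescent` is the DEGENERATE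
conic-edge family `R-HCx°` (`E′(4E′G′ − F′²) = 0`; blueprint: the same even/odd + chart-`t = H` recipe
after expanding `(mℓ + sq₂√Δ)²`) and the exceptional-tangency sections `R-Eθ` of the two-variable problem.
[KontsevichZagier2001 §1.2; this node] -/
theorem quadricBakerDescent_of_residuals₉
    (hc : (∀ (e g m γ q0 q1 q2 s : ℚ), 0 < e → 1 ≤ m → (s = 1 ∨ s = -1) →
      ((m + q2 ^ 2) * e - m * q1 ^ 2) *
          (4 * ((m + q2 ^ 2) * e - m * q1 ^ 2) * ((m + q2 ^ 2) * g - m * q0 ^ 2) - (2 * m * q0 * q1) ^ 2) = 0 →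
      ∀ (S : Set (Fin 1 → ℝ)), IsSemialgebraic ℚ S →
        (∀ t ∈ S, (0 ≤ t 0 ∧ t 0 ≤ 1) ∧ 0 < (e : ℝ) * t 0 ^ 2 + g ∧
          0 < ((m : ℝ) + q2 ^ 2) * ((e : ℝ) * t 0 ^ 2 + g) - m * ((q0 : ℝ) + q1 * t 0) ^ 2) →
        ∀ r : KZ.IntegralRep 1, r.domain = S →
          EqOn r.integrand (fun t => (γ : ℝ) * ((e : ℝ) / 3 * t 0 ^ 3 + g * t 0) * ((q1 : ℝ) * g - e * q0 * t 0) *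
            ((m : ℝ) * ((q0 : ℝ) + q1 * t 0) +
              s * q2 * √(((m : ℝ) + q2 ^ 2) * ((e : ℝ) * t 0 ^ 2 + g) - m * ((q0 : ℝ) + q1 * t 0) ^ 2)) ^ 2 /
            (((e : ℝ) * t 0 ^ 2 + g) ^ 2 *
              √(((m : ℝ) + q2 ^ 2) * ((e : ℝ) * t 0 ^ 2 + g) - m * ((q0 : ℝ) + q1 * t 0) ^ 2))) S →
          InBaker (KZ.of r)))
    (hθ : (∀ (L : Quadric₃) (ℓ₁ ℓ₂ g : Wall) (γ : ℚ) (σ : Fin 6 → SignType) (r : KZ.IntegralRep 2),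
      0 < L.dq.disc →
      ¬((L.bwall ℓ₁).precomp L.dq.lagM.inv ∈ goodWalls 1 L.dq.eκ L.dq.d11 L.dq.cst ∧
          (L.bwall ℓ₂).precomp L.dq.lagM.inv ∈ goodWalls 1 L.dq.eκ L.dq.d11 L.dq.cst) →
      r.domain = atomFam (L.wfam ℓ₁ ℓ₂ g) σ →
      EqOn r.integrand (fun v => (γ : ℝ) * √(L.Dxy (v 0) (v 1))) r.domain → InBaker (KZ.of r))) :
    Summit.KontsevichZagierPeriods.KontsevichZagierPeriods.Theses.RootDecompWalshStrata.QuadricBakerDescent :=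
  quadricBakerDescent_of_residuals₈ InBaker.of_Hlines_xdd hc hθ

end Summit.KontsevichZagierPeriods.RootDecompWalshStrata.ConicDescent.BallCube
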